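import Literature.Geometry.Riemannian.SurgicalRicciFlowPieces
import Literature.Topology.FourManifolds.SmoothEmbeddingCriteria
import HarnessLib

/-!
# Absorbing the ball pieces of a surgery step (the surgery caps are unique up to diffeomorphism)

Part of the deduction of Hamilton's Cor. 1.2(a) (`Literature.Geometry.Riemannian.hamilton_chen_tang_zhu`)
from Chen–Zhu's structure theorem for the Ricci flow with surgery
(`Literature.Geometry.Riemannian.chenZhu_ricciFlowWithSurgery`, `SurgicalRicciFlow.lean`) and
Cerf's `π₀ Diff(S³) = 0` (`Literature.Topology.FourManifolds.cerf_pi0Diff_sphere_three`).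

The surgery step of Chen–Zhu's Thm. 1.1 (ii)–(iii) (`IsSurgeryStep`) identifies compact domains
`N ⊆ M_k`, `N' ⊆ M_{k+1}` by a diffeomorphism `Φ` of open neighbourhoods, and describes the
complements by collared pieces; on the side of `M_{k+1}` all pieces are collared balls
`ι' : ℝ⁴ ↪ M_{k+1}`, `ι'(𝔹⁴)` a component of `M_{k+1} ∖ N'`, `ι'(ℝ⁴ ∖ 𝔹⁴) ⊆ N'`. After the necks
of `M_k` have been cut and capped, the `M_k`-side has the same shape, and the two closed
manifolds are then "the same `N` capped off by 4-balls along its boundary 3-spheres", but with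
caps attached by unrelated collars: through `Φ` the two collars of a boundary sphere differ by
an arbitrary diffeomorphism of `S³` (see the module docstring of
`SurgicalRicciFlowTopology.lean`). This file proves that the two capped manifolds are nevertheless
diffeomorphic, **given Cerf's theorem**, by absorbing the balls into `N` one at a time and
extending `Φ` across each of them with the ball-filling lemma
`Literature.Topology.FourManifolds.exists_ballFill_of_shellEmbedding` (`ShellCapExtension.lean`:
Cerf's `Γ₄ = 0` in ambient form plus uniqueness of collars of `∂𝔻⁴`).

## The setting (unbundled, as in `AreIsometricDomains` / `IsSurgeryStep`)

`Z`, `M'` Hausdorff `C^∞` 4-manifolds; `N ⊆ Z`, `N' ⊆ M'`; open `U ⊇ N`, `U'`; maps `Φ : Z → M'`,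
`Ψ : M' → Z`, `C^∞` on `U`, `U'`, mutually inverse there, with `Φ '' N = N' ∩ U'`; the components
of `Z ∖ N` and of `M' ∖ N'` finite and all collared ball pieces; and every boundary sphere
`frontier C'` of a ball piece of `M' ∖ N'` either inside `U'` or disjoint from it (this trichotomy-
free condition is what survives restriction to components and cutting of necks upstream).

## Main results

* `exists_ballPiece_frontier_image_eq`: the boundary sphere `ι(S³)` of a ball piece of `Z ∖ N` is
  carried by `Φ` **onto** the boundary sphere `ι'(S³)` of a ball piece of `M' ∖ N'` (no
  invariance of domain is used: `Φ(ι S³) ⊆ ι'(S³)` by a limit argument along the collar and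
  connectedness of thin shells, and the reverse inclusion by the same argument for `Ψ`).
* `exists_absorb_ballPiece`: **one absorption step** — the data above with `k + 1` ball pieces on
  the `Z`-side yield data of the same kind for `N ∪ C`, `N' ∪ C'` with `k` pieces (Cerf).
* `exists_diffeoOn_univ_of_ballPieces`: by induction, `Φ` extends to a diffeomorphism of all
  of `Z` onto an open subset of `M'`; hence (`exists_diffeomorph_component_of_ballPieces`) a
  compact connected `Z` is diffeomorphic to a connected component of `M'`.

## References

* B.-L. Chen, X.-P. Zhu, *Ricci flow with surgery on four-manifolds with positive isotropic
  curvature*, J. Differential Geom. 74 (2006) 177–264, Thm. 1.1 (ii)–(iii) and §5, p. 25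
  (reconstruction of `M⁴` from the pieces). [ChenZhu2006]
* R. S. Hamilton, *Four-manifolds with positive isotropic curvature*, Comm. Anal. Geom. 5 (1997),
  §1.1 pp. 3–4. [Hamilton1997]
* J. Cerf, *Sur les difféomorphismes de la sphère de dimension trois (Γ₄ = 0)*, LNM 53 (1968).
* J. Milnor, *Lectures on the h-cobordism theorem* (1965), §9.
-/

noncomputable section

open Set Function Metric TopologicalSpace Filter
open scoped Manifold ContDiff Topology

namespace Literature.Geometry.Riemannian

open Literature.Topology.FourManifolds

section General

variable {Z M' : Type*} [TopologicalSpace Z] [TopologicalSpace M']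

omit [TopologicalSpace Z] [TopologicalSpace M'] in
/-- For mutually inverse maps `Φ : U → U'`, `Ψ : U' → U`: `Φ '' U = U'`. [folklore] -/
theorem image_eq_of_inverse {U : Set Z} {U' : Set M'} {Φ : Z → M'} {Ψ : M' → Z}
    (hΦ : MapsTo Φ U U') (hΨ : MapsTo Ψ U' U) (hright : ∀ y ∈ U', Φ (Ψ y) = y) :
    Φ '' U = U' :=
  Subset.antisymm (mapsTo_iff_image_subset.1 hΦ) fun y hy => ⟨Ψ y, hΨ hy, hright y hy⟩

/-- For mutually inverse continuous maps of open sets, `Φ` maps open subsets of `U` to open sets.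
[folklore] -/
theorem isOpen_image_of_inverse {U O : Set Z} {U' : Set M'} {Φ : Z → M'} {Ψ : M' → Z}
    (hU' : IsOpen U') (hΨc : ContinuousOn Ψ U') (hΦ : MapsTo Φ U U') (hΨ : MapsTo Ψ U' U)
    (hleft : ∀ x ∈ U, Ψ (Φ x) = x) (hright : ∀ y ∈ U', Φ (Ψ y) = y) (hO : IsOpen O)
    (hOU : O ⊆ U) : IsOpen (Φ '' O) := by
  have hΦU : Φ '' U = U' := image_eq_of_inverse hΦ hΨ hright
  exact isOpen_image_of_leftInvOn (hΦU.symm ▸ hU') (hΦU.symm ▸ hΨc) hleft hO hOU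

omit [TopologicalSpace Z] [TopologicalSpace M'] in
/-- Mutually inverse maps on `U`, `U'`: `Φ` maps `U ∖ N` into `U' ∖ N'` when `Φ '' N = N' ∩ U'`
and `N ⊆ U`. [folklore] -/
theorem image_notMem_of_inverse {U N : Set Z} {U' N' : Set M'} {Φ : Z → M'} {Ψ : M' → Z}
    (hNU : N ⊆ U) (hΦ : MapsTo Φ U U') (hleft : ∀ x ∈ U, Ψ (Φ x) = x) (hΦN : Φ '' N = N' ∩ U')
    {z : Z} (hz : z ∈ U) (hzN : z ∉ N) : Φ z ∉ N' := by
  intro h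
  obtain ⟨z₀, hz₀, he⟩ := (hΦN.symm ▸ ⟨h, hΦ hz⟩ : Φ z ∈ Φ '' N)
  have : z₀ = z := by rw [← hleft z₀ (hNU hz₀), he, hleft z hz]
  exact hzN (this ▸ hz₀)

/-- `Φ` carries `N ∩ U`-interior points to interior points of `N'` (it is an open map on `U`).
[folklore] -/
theorem image_mem_interior_of_inverse {U N : Set Z} {U' N' : Set M'} {Φ : Z → M'} {Ψ : M' → Z}
    (hU : IsOpen U) (hU' : IsOpen U') (hΨc : ContinuousOn Ψ U') (hΦ : MapsTo Φ U U')
    (hΨ : MapsTo Ψ U' U) (hleft : ∀ x ∈ U, Ψ (Φ x) = x) (hright : ∀ y ∈ U', Φ (Ψ y) = y)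
    (hΦN : Φ '' N = N' ∩ U') {z : Z} (hzU : z ∈ U) (hz : z ∈ interior N) :
    Φ z ∈ interior N' := by
  rw [mem_interior] at hz ⊢
  obtain ⟨V, hVN, hV, hzV⟩ := hz
  refine ⟨Φ '' (V ∩ U), ?_, isOpen_image_of_inverse hU' hΨc hΦ hΨ hleft hright (hV.inter hU)
    inter_subset_right, mem_image_of_mem Φ ⟨hzV, hzU⟩⟩
  calc Φ '' (V ∩ U) ⊆ Φ '' N := image_mono fun x hx => hVN hx.1
    _ = N' ∩ U' := hΦN
    _ ⊆ N' := inter_subset_left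

end General

/-! ### Boundary spheres are matched by `Φ` -/

section Matching

variable {Z : Type} [TopologicalSpace Z] [T2Space Z] [ChartedSpace (EuclideanSpace ℝ (Fin 4)) Z]
  {M' : Type} [TopologicalSpace M'] [T2Space M'] [ChartedSpace (EuclideanSpace ℝ (Fin 4)) M']

omit [T2Space Z] [ChartedSpace (EuclideanSpace ℝ (Fin 4)) Z] [T2Space M']
  [ChartedSpace (EuclideanSpace ℝ (Fin 4)) M'] in
/-- **Limit along a collar.** If `Φ` is continuous at `ι x` (`‖x‖ = 1`), `ι` continuous, and
`Φ (ι (t • x)) ∈ C'` for `1 - δ < t < 1`, then `Φ (ι x) ∈ closure C'`. [folklore] -/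
theorem mem_closure_of_collar {ι : EuclideanSpace ℝ (Fin 4) → Z} (hι : Continuous ι)
    {Φ : Z → M'} {x : EuclideanSpace ℝ (Fin 4)} (hΦ : ContinuousAt Φ (ι x)) {C' : Set M'}
    {δ : ℝ} (hδ : 0 < δ) (hmem : ∀ t : ℝ, 1 - δ < t → t < 1 → Φ (ι (t • x)) ∈ C') :
    Φ (ι x) ∈ closure C' := by
  have hg : ContinuousAt (fun t : ℝ => Φ (ι (t • x))) 1 := by
    have h1 : ContinuousAt (fun t : ℝ => ι (t • x)) 1 :=
      (hι.comp (continuous_id.smul continuous_const)).continuousAt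
    have h2 : ContinuousAt Φ ((fun t : ℝ => ι (t • x)) 1) := by simp only [one_smul]; exact hΦ
    exact ContinuousAt.comp (f := fun t : ℝ => ι (t • x)) h2 h1
  have ht : Tendsto (fun t : ℝ => Φ (ι (t • x))) (𝓝[<] 1) (𝓝 (Φ (ι x))) := by
    have := hg.continuousWithinAt (s := Iio 1)
    simpa using this.tendsto
  refine mem_closure_of_tendsto ht ?_
  filter_upwards [Ioo_mem_nhdsLT (show 1 - δ < (1 : ℝ) by linarith)] with t ht
  exact hmem t ht.1 ht.2

omit [T2Space Z] [ChartedSpace (EuclideanSpace ℝ (Fin 4)) Z] [T2Space M']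
  [ChartedSpace (EuclideanSpace ℝ (Fin 4)) M'] in
/-- **The boundary sphere of a ball piece is carried into the boundary sphere of a ball piece
on the other side.** Let `C = ι(𝔹⁴)` be a ball piece of `Z ∖ N` (`N` closed) whose boundary
sphere `ι(S³)` lies in the open set `U`, and `Φ` continuous on `U` with `Φ (U ∖ N) ∩ N' = ∅`,
`Φ (U ∩ N) ⊆ N'`. Then there is a component `C'` of `M' ∖ N'` with `Φ (ι S³) ⊆ closure C' ∖ C'`:
a thin inner shell of the collar is mapped into a single component `C'`
(`exists_mem_componentsOf_image_shell_subset`), so each `Φ (ι x)`, `‖x‖ = 1`, is a limit of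
points of `C'` (`mem_closure_of_collar`) lying in `N'`. [folklore] -/
theorem exists_image_sphere_subset_closure_diff {N : Set Z} {N' : Set M'} {U : Set Z}
    {Φ : Z → M'} (hU : IsOpen U) (hΦc : ContinuousOn Φ U)
    (hout : ∀ z ∈ U, z ∉ N → Φ z ∉ N') (hin : ∀ z ∈ U, z ∈ N → Φ z ∈ N')
    {C : Set Z} (hC : C ∈ componentsOf Nᶜ) {ι : EuclideanSpace ℝ (Fin 4) → Z}
    (hι : Continuous ι) (hιC : ι '' ball 0 1 = C) (hιN : ι '' (ball 0 1)ᶜ ⊆ N)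
    (hSU : ι '' sphere 0 1 ⊆ U) :
    ∃ C' ∈ componentsOf N'ᶜ, Φ '' (ι '' sphere 0 1) ⊆ closure C' \ C' := by
  have hCN := disjoint_of_mem_componentsOf_compl hC
  have hmem := IsBallPiece.mem_iff_of_witness hCN hιC hιN
  have hΦN' : ∀ x : EuclideanSpace ℝ (Fin 4), ‖x‖ < 1 → ι x ∈ U → Φ (ι x) ∈ N'ᶜ :=
    fun x hx hxU => hout _ hxU fun h => by have := (hmem x).1 h; linarith
  obtain ⟨δ, hδ, hδh, -, C', hC', hshell⟩ :=
    exists_mem_componentsOf_image_shell_subset hι hU hSU hΦc hΦN'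
  refine ⟨C', hC', ?_⟩
  rintro _ ⟨_, ⟨x, hx, rfl⟩, rfl⟩
  have hx1 : ‖x‖ = 1 := mem_sphere_zero_iff_norm.1 hx
  have hxU : ι x ∈ U := hSU (mem_image_of_mem ι hx)
  refine ⟨mem_closure_of_collar hι (hΦc.continuousAt (hU.mem_nhds hxU)) hδ
    fun t h1 h2 => hshell (t • x) ?_ ?_, fun h => ?_⟩
  · have ht : 0 < t := by linarith
    rw [norm_smul, Real.norm_eq_abs, abs_of_pos ht, hx1, mul_one]; exact h1
  · have ht : 0 < t := by linarith
    rw [norm_smul, Real.norm_eq_abs, abs_of_pos ht, hx1, mul_one]; exact h2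
  · exact subset_of_mem_componentsOf hC' h (hin _ hxU ((hmem x).2 hx1.ge))

/-- **Boundary spheres are matched.** In the setting of the module docstring (`N`, `N'` closed,
all pieces on both sides collared balls, boundary spheres of `M'`-pieces inside `U'` or disjoint
from it), for every ball piece `C = ι(𝔹⁴)` of `Z ∖ N` there is a ball piece `C' = ι'(𝔹⁴)` of
`M' ∖ N'` with `Φ (ι S³) = ι' S³` **exactly**, and `ι' S³ ⊆ U'`. The inclusion `⊆` is
`exists_image_sphere_subset_closure_diff`; then `ι' S³` meets `U'`, so lies in it, and the same
lemma for `Ψ` puts `Ψ (ι' S³)` inside the boundary sphere of a ball piece of `Z ∖ N` meeting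
`ι S³`, which must be `C` itself (`IsBallPiece.eq_of_mem_closure`). No invariance of domain is
used. [folklore] -/
theorem exists_ballPiece_frontier_image_eq {N : Set Z} {N' : Set M'} {U : Set Z} {U' : Set M'}
    {Φ : Z → M'} {Ψ : M' → Z} (hN' : IsClosed N') (hU : IsOpen U)
    (hNU : N ⊆ U) (hU' : IsOpen U') (hΦc : ContinuousOn Φ U) (hΨc : ContinuousOn Ψ U')
    (hΦ : MapsTo Φ U U')
    (hleft : ∀ x ∈ U, Ψ (Φ x) = x) (hright : ∀ y ∈ U', Φ (Ψ y) = y) (hΦN : Φ '' N = N' ∩ U')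
    (hZ : ∀ C ∈ componentsOf Nᶜ, IsBallPiece N C)
    (hM : ∀ C' ∈ componentsOf N'ᶜ, IsBallPiece N' C')
    (hfr : ∀ C' ∈ componentsOf N'ᶜ, frontier C' ⊆ U' ∨ Disjoint (frontier C') U')
    {C : Set Z} (hC : C ∈ componentsOf Nᶜ) {ι : EuclideanSpace ℝ (Fin 4) → Z}
    (hι : Manifold.IsSmoothEmbedding (𝓡 4) (𝓡 4) ∞ ι)
    (hιC : ι '' ball 0 1 = C) (hιN : ι '' (ball 0 1)ᶜ ⊆ N) :
    ∃ C' ∈ componentsOf N'ᶜ, ∃ ι' : EuclideanSpace ℝ (Fin 4) → M',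
      Manifold.IsSmoothEmbedding (𝓡 4) (𝓡 4) ∞ ι' ∧ IsOpen (range ι') ∧
      ι' '' ball 0 1 = C' ∧ ι' '' (ball 0 1)ᶜ ⊆ N' ∧
      Φ '' (ι '' sphere 0 1) = ι' '' sphere 0 1 ∧ ι' '' sphere 0 1 ⊆ U' := by
  haveI : LocallyConnectedSpace M' :=
    ChartedSpace.locallyConnectedSpace (EuclideanSpace ℝ (Fin 4)) M'
  haveI : LocallyConnectedSpace Z :=
    ChartedSpace.locallyConnectedSpace (EuclideanSpace ℝ (Fin 4)) Z
  have hιc : Continuous ι := hι.contMDiff.continuous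
  have hιinj : Injective ι := hι.isEmbedding.injective
  have hCN := disjoint_of_mem_componentsOf_compl hC
  have hmem := IsBallPiece.mem_iff_of_witness hCN hιC hιN
  -- the two "`Φ` respects `N`" hypotheses, on both sides
  have houtΦ : ∀ z ∈ U, z ∉ N → Φ z ∉ N' := fun z hz hzN =>
    image_notMem_of_inverse hNU hΦ hleft hΦN hz hzN
  have hinΦ : ∀ z ∈ U, z ∈ N → Φ z ∈ N' := fun z _ hzN => by
    have : Φ z ∈ Φ '' N := mem_image_of_mem Φ hzN
    rw [hΦN] at this
    exact this.1
  have houtΨ : ∀ y ∈ U', y ∉ N' → Ψ y ∉ N := fun y hy hyN h => by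
    have : Φ (Ψ y) ∈ Φ '' N := mem_image_of_mem Φ h
    rw [hright y hy, hΦN] at this
    exact hyN this.1
  have hinΨ : ∀ y ∈ U', y ∈ N' → Ψ y ∈ N := fun y hy hyN => by
    obtain ⟨z, hz, rfl⟩ := (hΦN.symm ▸ ⟨hyN, hy⟩ : y ∈ Φ '' N)
    rw [hleft z (hNU hz)]
    exact hz
  have hSU : ι '' sphere 0 1 ⊆ U := by
    rintro _ ⟨x, hx, rfl⟩
    exact hNU ((hmem x).2 (mem_sphere_zero_iff_norm.1 hx).ge)
  -- Step 1: `Φ (ι S³) ⊆` the boundary sphere of some `C'`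
  obtain ⟨C', hC', hsub⟩ :=
    exists_image_sphere_subset_closure_diff hU hΦc houtΦ hinΦ hC hιc hιC hιN hSU
  obtain ⟨ι', hι', hι'o, hι'C, hι'N⟩ := hM C' hC'
  have hι'c : Continuous ι' := hι'.contMDiff.continuous
  have hι'inj : Injective ι' := hι'.isEmbedding.injective
  have hC'N := disjoint_of_mem_componentsOf_compl hC'
  have hmem' := IsBallPiece.mem_iff_of_witness hC'N hι'C hι'N
  have hC'o : IsOpen C' := isOpen_of_mem_componentsOf hN'.isOpen_compl hC'
  have hcd' : closure C' \ C' = ι' '' sphere 0 1 :=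
    IsBallPiece.closure_diff_eq_of_witness hι'c hι'inj hι'C
  rw [hcd'] at hsub
  -- Step 2: the sphere `ι' S³` meets `U'`, hence lies in it
  have hS'U : ι' '' sphere 0 1 ⊆ U' := by
    rcases hfr C' hC' with h | h
    · rwa [hC'o.frontier_eq, hcd'] at h
    · exfalso
      rw [hC'o.frontier_eq, hcd'] at h
      set x₀ : EuclideanSpace ℝ (Fin 4) := EuclideanSpace.single 0 1 with hx₀
      have hx₀s : x₀ ∈ sphere (0 : EuclideanSpace ℝ (Fin 4)) 1 := by simp [hx₀]
      have h1 : Φ (ι x₀) ∈ ι' '' sphere 0 1 := hsub ⟨ι x₀, mem_image_of_mem ι hx₀s, rfl⟩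
      have h2 : Φ (ι x₀) ∈ U' := hΦ (hSU (mem_image_of_mem ι hx₀s))
      exact h.le_bot ⟨h1, h2⟩
  -- Step 3: the same lemma for `Ψ` puts `Ψ (ι' S³)` in the boundary sphere of `C`
  obtain ⟨C₂, hC₂, hsub₂⟩ :=
    exists_image_sphere_subset_closure_diff hU' hΨc houtΨ hinΨ hC' hι'c hι'C hι'N hS'U
  have hSsub : ι '' sphere 0 1 ⊆ Ψ '' (ι' '' sphere 0 1) := fun z hz =>
    ⟨Φ z, hsub (mem_image_of_mem Φ hz), hleft z (hSU hz)⟩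
  have hCC₂ : C = C₂ := by
    set x₀ : EuclideanSpace ℝ (Fin 4) := EuclideanSpace.single 0 1 with hx₀
    have hx₀s : x₀ ∈ sphere (0 : EuclideanSpace ℝ (Fin 4)) 1 := by simp [hx₀]
    have hz₀ : ι x₀ ∈ closure C \ C := by
      rw [IsBallPiece.closure_diff_eq_of_witness hιc hιinj hιC]
      exact mem_image_of_mem ι hx₀s
    exact IsBallPiece.eq_of_mem_closure hC hC₂ (hZ C hC) hz₀
      (hsub₂ (hSsub (mem_image_of_mem ι hx₀s))).1
  subst hCC₂
  rw [IsBallPiece.closure_diff_eq_of_witness hιc hιinj hιC] at hsub₂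
  refine ⟨C', hC', ι', hι', hι'o, hι'C, hι'N, Subset.antisymm hsub fun y hy => ?_, hS'U⟩
  exact ⟨Ψ y, hsub₂ (mem_image_of_mem Ψ hy), hright y (hS'U hy)⟩

end Matching



/-! ### The transition map of a matched pair of collars, and its ball filling -/

section CapFill

variable {Z : Type} [TopologicalSpace Z] [ChartedSpace (EuclideanSpace ℝ (Fin 4)) Z]
  {M' : Type} [TopologicalSpace M'] [ChartedSpace (EuclideanSpace ℝ (Fin 4)) M']

/-- **Filling the transition map of two matched collars** (Cerf). Setting of the module
docstring, with a ball piece `C = ι(𝔹⁴)` of `Z ∖ N` and a ball piece `C' = ι'(𝔹⁴)` of `M' ∖ N'`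
whose boundary spheres correspond under `Φ` (`Φ (ι S³) = ι' S³`,
`exists_ballPiece_frontier_image_eq`). The transition map `f = ι'⁻¹ ∘ Φ ∘ ι` is then a
sphere-preserving embedding of a two-sided shell `{1 - ε < ‖x‖ < 1 + ε}` exchanging neither
side (`Φ` maps `U ∖ N` to `M' ∖ N'` and the interior of `N` to the interior of `N'`), so
`Literature.Topology.FourManifolds.exists_ballFill_of_shellEmbedding` fills it by a ball: a `C^∞`
embedding `F` of `B(0, 1 + δ)` with `ι' ∘ F = Φ ∘ ι` on the thin shell `{1 - δ < ‖x‖ < 1 + δ}`,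
`F(𝔹⁴) = 𝔹⁴`, open image `𝔹⁴ ∪ f({1 ≤ ‖x‖ < 1 + δ})` and a `C^∞` inverse there.
[cite: CerfDiffeoSphere1968, Ch. I §1, Théorème 1 and Corollaire 1] -/
theorem exists_capFill [T2Space M'] (hcerf : cerf_pi0Diff_sphere_three)
    {N : Set Z} {N' : Set M'} {U : Set Z} {U' : Set M'} {Φ : Z → M'} {Ψ : M' → Z}
    (hU : IsOpen U) (hNU : N ⊆ U) (hU' : IsOpen U')
    (hΦc : ContMDiffOn (𝓡 4) (𝓡 4) ∞ Φ U) (hΨc : ContMDiffOn (𝓡 4) (𝓡 4) ∞ Ψ U')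
    (hΦ : MapsTo Φ U U') (hΨ : MapsTo Ψ U' U)
    (hleft : ∀ x ∈ U, Ψ (Φ x) = x) (hright : ∀ y ∈ U', Φ (Ψ y) = y) (hΦN : Φ '' N = N' ∩ U')
    {C : Set Z} (hC : C ∈ componentsOf Nᶜ) {ι : EuclideanSpace ℝ (Fin 4) → Z}
    (hι : Manifold.IsSmoothEmbedding (𝓡 4) (𝓡 4) ∞ ι) (hιo : IsOpen (range ι))
    (hιC : ι '' ball 0 1 = C) (hιN : ι '' (ball 0 1)ᶜ ⊆ N)
    {C' : Set M'} (hC' : C' ∈ componentsOf N'ᶜ) {ι' : EuclideanSpace ℝ (Fin 4) → M'}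
    (hι' : Manifold.IsSmoothEmbedding (𝓡 4) (𝓡 4) ∞ ι') (hι'o : IsOpen (range ι'))
    (hι'C : ι' '' ball 0 1 = C') (hι'N : ι' '' (ball 0 1)ᶜ ⊆ N')
    (hSS' : Φ '' (ι '' sphere 0 1) = ι' '' sphere 0 1) :
    ∃ (F Finv : EuclideanSpace ℝ (Fin 4) → EuclideanSpace ℝ (Fin 4)) (δ : ℝ), 0 < δ ∧
      ContDiffOn ℝ ∞ F (ball 0 (1 + δ)) ∧
      (∀ x : EuclideanSpace ℝ (Fin 4), 1 - δ < ‖x‖ → ‖x‖ < 1 + δ →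
        ι x ∈ U ∧ Φ (ι x) ∈ U' ∧ ι' (F x) = Φ (ι x)) ∧
      F '' ball 0 1 = ball 0 1 ∧
      (∀ w ∈ F '' ball 0 (1 + δ), ‖w‖ < 1 ∨
        ∃ x : EuclideanSpace ℝ (Fin 4), 1 ≤ ‖x‖ ∧ ‖x‖ < 1 + δ ∧ F x = w) ∧
      IsOpen (F '' ball 0 (1 + δ)) ∧
      ContDiffOn ℝ ∞ Finv (F '' ball 0 (1 + δ)) ∧
      ∀ x ∈ ball (0 : EuclideanSpace ℝ (Fin 4)) (1 + δ), Finv (F x) = x := by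
  have hιc : Continuous ι := hι.contMDiff.continuous
  have hιinj : Injective ι := hι.isEmbedding.injective
  have hιoe : Topology.IsOpenEmbedding ι := ⟨hι.isEmbedding, hιo⟩
  have hι'c : Continuous ι' := hι'.contMDiff.continuous
  have hι'inj : Injective ι' := hι'.isEmbedding.injective
  have hι'oe : Topology.IsOpenEmbedding ι' := ⟨hι'.isEmbedding, hι'o⟩
  have hCN := disjoint_of_mem_componentsOf_compl hC
  have hC'N := disjoint_of_mem_componentsOf_compl hC'
  have hmem := IsBallPiece.mem_iff_of_witness hCN hιC hιN
  have hmem' := IsBallPiece.mem_iff_of_witness hC'N hι'C hι'N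
  have houtΦ : ∀ z ∈ U, z ∉ N → Φ z ∉ N' := fun z hz hzN =>
    image_notMem_of_inverse hNU hΦ hleft hΦN hz hzN
  have hinΦ : ∀ z ∈ U, z ∈ N → Φ z ∈ N' := fun z _ hzN => by
    have : Φ z ∈ Φ '' N := mem_image_of_mem Φ hzN
    rw [hΦN] at this
    exact this.1
  -- the inverse charts of the two collars
  set eι := hιoe.toOpenPartialHomeomorph ι with heι
  set eι' := hι'oe.toOpenPartialHomeomorph ι' with heι'
  have heιs : ∀ x, eι.symm (ι x) = x := fun x => hιoe.toOpenPartialHomeomorph_left_inv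
  have heι's : ∀ y, eι'.symm (ι' y) = y := fun y => hι'oe.toOpenPartialHomeomorph_left_inv
  have heι'a : ∀ {p}, p ∈ range ι' → ι' (eι'.symm p) = p :=
    fun hp => Topology.IsOpenEmbedding.toOpenPartialHomeomorph_right_inv ι' hι'oe hp
  have heιc : ContMDiffOn (𝓡 4) 𝓘(ℝ, EuclideanSpace ℝ (Fin 4)) ∞ eι.symm (range ι) :=
    contMDiffOn_symm_of_isSmoothEmbedding hι hιoe
  have heι'c : ContMDiffOn (𝓡 4) 𝓘(ℝ, EuclideanSpace ℝ (Fin 4)) ∞ eι'.symm (range ι') :=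
    contMDiffOn_symm_of_isSmoothEmbedding hι' hι'oe
  -- the transition map and its inverse
  set f : EuclideanSpace ℝ (Fin 4) → EuclideanSpace ℝ (Fin 4) := fun x => eι'.symm (Φ (ι x))
    with hfdef
  set finv : EuclideanSpace ℝ (Fin 4) → EuclideanSpace ℝ (Fin 4) :=
    fun y => eι.symm (Ψ (ι' y)) with hfinvdef
  -- a two-sided shell on which `ι` maps into `U` and `Φ ∘ ι` into `range ι'`
  set O : Set (EuclideanSpace ℝ (Fin 4)) := ι ⁻¹' (U ∩ Φ ⁻¹' range ι') with hOdef
  have hOo : IsOpen O := (hΦc.continuousOn.isOpen_inter_preimage hU hι'o).preimage hιc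
  have hSO : sphere (0 : EuclideanSpace ℝ (Fin 4)) 1 ⊆ O := fun x hx => by
    have hx1 := mem_sphere_zero_iff_norm.1 hx
    refine ⟨hNU ((hmem x).2 hx1.ge), ?_⟩
    have : Φ (ι x) ∈ Φ '' (ι '' sphere 0 1) := mem_image_of_mem Φ (mem_image_of_mem ι hx)
    rw [hSS'] at this
    exact (image_subset_range ι' _) this
  obtain ⟨ε, hε, -, hεO⟩ := exists_twoSidedShell_subset hOo hSO
  set S : Set (EuclideanSpace ℝ (Fin 4)) := {x | 1 - ε < ‖x‖ ∧ ‖x‖ < 1 + ε} with hSdef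
  have hSO' : ∀ x ∈ S, ι x ∈ U ∧ Φ (ι x) ∈ range ι' := fun x hx => hεO x hx.1 hx.2
  have hSopen : IsOpen S :=
    (isOpen_lt continuous_const continuous_norm).inter (isOpen_lt continuous_norm continuous_const)
  have hf_apply : ∀ x ∈ S, ι' (f x) = Φ (ι x) := fun x hx => heι'a (hSO' x hx).2
  -- smoothness of `f` on the shell
  have hf : ContDiffOn ℝ ∞ f S := by
    rw [← contMDiffOn_iff_contDiffOn]
    have h1 : ContMDiffOn 𝓘(ℝ, EuclideanSpace ℝ (Fin 4)) (𝓡 4) ∞ (fun x => Φ (ι x)) S :=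
      hΦc.comp hι.contMDiff.contMDiffOn fun x hx => (hSO' x hx).1
    exact heι'c.comp h1 fun x hx => (hSO' x hx).2
  -- the image of the shell is open
  have hfS : f '' S = eι'.symm '' (Φ '' (ι '' S)) := by simp only [hfdef, image_image]
  have hιSo : IsOpen (ι '' S) := hιoe.isOpenMap _ hSopen
  have hΦιSo : IsOpen (Φ '' (ι '' S)) :=
    isOpen_image_of_inverse hU' hΨc.continuousOn hΦ hΨ hleft hright hιSo
      (by rintro _ ⟨x, hx, rfl⟩; exact (hSO' x hx).1)
  have hfo : IsOpen (f '' S) := by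
    rw [hfS]
    refine eι'.symm.isOpen_image_of_subset_source hΦιSo ?_
    rw [OpenPartialHomeomorph.symm_source, heι', Topology.IsOpenEmbedding.toOpenPartialHomeomorph_target]
    rintro _ ⟨_, ⟨x, hx, rfl⟩, rfl⟩
    exact (hSO' x hx).2
  -- the inverse is smooth on the image and is a left inverse
  have hfinv : ContDiffOn ℝ ∞ finv (f '' S) := by
    rw [← contMDiffOn_iff_contDiffOn]
    have h1 : ContMDiffOn 𝓘(ℝ, EuclideanSpace ℝ (Fin 4)) (𝓡 4) ∞ (fun y => Ψ (ι' y)) (f '' S) := by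
      refine hΨc.comp hι'.contMDiff.contMDiffOn ?_
      rintro _ ⟨x, hx, rfl⟩
      show ι' (f x) ∈ U'
      rw [hf_apply x hx]
      exact hΦ (hSO' x hx).1
    refine heιc.comp h1 ?_
    rintro _ ⟨x, hx, rfl⟩
    show Ψ (ι' (f x)) ∈ range ι
    rw [hf_apply x hx, hleft _ (hSO' x hx).1]
    exact mem_range_self x
  have hleft_f : ∀ x : EuclideanSpace ℝ (Fin 4), 1 - ε < ‖x‖ → ‖x‖ < 1 + ε → finv (f x) = x :=
    fun x h1 h2 => by
      show eι.symm (Ψ (ι' (f x))) = x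
      rw [hf_apply x ⟨h1, h2⟩, hleft _ (hSO' x ⟨h1, h2⟩).1, heιs]
  -- the sphere is preserved
  have hsph : f '' sphere 0 1 = sphere 0 1 := by
    have : f '' sphere 0 1 = eι'.symm '' (Φ '' (ι '' sphere 0 1)) := by
      simp only [hfdef, image_image]
    rw [this, hSS', image_image]
    conv_rhs => rw [← image_id (sphere (0 : EuclideanSpace ℝ (Fin 4)) 1)]
    exact image_congr fun y _ => heι's y
  -- the two sides are preserved
  have hin : ∀ x : EuclideanSpace ℝ (Fin 4), 1 - ε < ‖x‖ → ‖x‖ < 1 → ‖f x‖ < 1 := by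
    intro x h1 h2
    have hxS : x ∈ S := ⟨h1, by linarith⟩
    have hxN : ι x ∉ N := fun h => by have := (hmem x).1 h; linarith
    have h3 : Φ (ι x) ∉ N' := houtΦ _ (hSO' x hxS).1 hxN
    by_contra h4
    exact h3 (hf_apply x hxS ▸ (hmem' (f x)).2 (not_lt.1 h4))
  have hout : ∀ x : EuclideanSpace ℝ (Fin 4), 1 < ‖x‖ → ‖x‖ < 1 + ε → 1 < ‖f x‖ := by
    intro x h1 h2
    have hxS : x ∈ S := ⟨by linarith, h2⟩
    have hint : ι x ∈ interior N :=
      IsBallPiece.image_subset_interior_of_witness hιoe.isOpenMap hιN (mem_image_of_mem ι h1)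
    have hint' : Φ (ι x) ∈ interior N' :=
      image_mem_interior_of_inverse hU hU' hΨc.continuousOn hΦ hΨ hleft hright hΦN
        (hSO' x hxS).1 hint
    rw [← hf_apply x hxS] at hint'
    rcases lt_trichotomy 1 ‖f x‖ with h | h | h
    · exact h
    · exfalso
      have hfr : ι' (f x) ∈ closure C' \ C' := by
        rw [IsBallPiece.closure_diff_eq_of_witness hι'c hι'inj hι'C]
        exact mem_image_of_mem ι' (mem_sphere_zero_iff_norm.2 h.symm)
      have := IsBallPiece.closure_diff_inter_interior hC'N
      exact (eq_empty_iff_forall_notMem.1 this) _ ⟨hfr, hint'⟩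
    · exfalso
      have : ι' (f x) ∈ C' := hι'C ▸ mem_image_of_mem ι' (mem_ball_zero_iff.2 h)
      exact hC'N.le_bot ⟨this, interior_subset hint'⟩
  -- Cerf: fill the shell embedding by a ball
  obtain ⟨F, Finv, δ, hδ, hδε, hF, hFf, hF1, hFimg, hFo, hFinv, hFleft⟩ :=
    exists_ballFill_of_shellEmbedding hcerf hε hf hfo hfinv hleft_f hsph hin hout
  refine ⟨F, Finv, δ, hδ, hF, fun x h1 h2 => ?_, hF1, fun w hw => ?_, hFo, hFinv, hFleft⟩
  · have hxS : x ∈ S := ⟨by linarith, by linarith⟩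
    refine ⟨(hSO' x hxS).1, hΦ (hSO' x hxS).1, ?_⟩
    rw [hFf x h1 h2, hf_apply x hxS]
  · rw [hFimg] at hw
    rcases hw with hw | ⟨x, hx, rfl⟩
    · exact Or.inl (mem_ball_zero_iff.1 hw)
    · exact Or.inr ⟨x, hx.1, hx.2, (hFf x (by linarith [hx.1]) hx.2)⟩

end CapFill


/-! ### One absorption step -/

section Absorb

variable {Z : Type} [TopologicalSpace Z] [T2Space Z] [ChartedSpace (EuclideanSpace ℝ (Fin 4)) Z]
  {M' : Type} [TopologicalSpace M'] [T2Space M'] [ChartedSpace (EuclideanSpace ℝ (Fin 4)) M']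

/-- **Absorbing one ball piece** (setting of the module docstring; Cerf). Given the data
`(N, N', U, U', Φ, Ψ)` with all pieces of `Z ∖ N` and `M' ∖ N'` collared balls and a ball piece
`C` of `Z ∖ N`, there are a ball piece `C'` of `M' ∖ N'` and new data `(U₁, U₁', Φ₁, Ψ₁)` of the
same kind for the enlarged closed sets `N ∪ C`, `N' ∪ C'`: `Φ₁ = Φ` away from `C`, and on a
collar neighbourhood `ι(B(0, 1 + δ))` of `closure C` it is `ι' ∘ F ∘ ι⁻¹` for the ball filling
`F` of the transition map (`exists_capFill`); the two definitions agree on the overlap because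
`F = ι'⁻¹ ∘ Φ ∘ ι` on the thin shell. The neighbourhood `U` is first shrunk so that `Φ` maps no
point outside the collar into `closure C'`, which makes the glued map injective.
[cite: CerfDiffeoSphere1968, Ch. I §1, Théorème 1 and Corollaire 1] -/
theorem exists_absorb_ballPiece (hcerf : cerf_pi0Diff_sphere_three)
    {N : Set Z} {N' : Set M'} {U : Set Z} {U' : Set M'} {Φ : Z → M'} {Ψ : M' → Z}
    (hN' : IsClosed N') (hU : IsOpen U) (hNU : N ⊆ U) (hU' : IsOpen U')
    (hΦc : ContMDiffOn (𝓡 4) (𝓡 4) ∞ Φ U) (hΨc : ContMDiffOn (𝓡 4) (𝓡 4) ∞ Ψ U')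
    (hΦ : MapsTo Φ U U') (hΨ : MapsTo Ψ U' U)
    (hleft : ∀ x ∈ U, Ψ (Φ x) = x) (hright : ∀ y ∈ U', Φ (Ψ y) = y) (hΦN : Φ '' N = N' ∩ U')
    (hZ : ∀ C ∈ componentsOf Nᶜ, IsBallPiece N C)
    (hM : ∀ C' ∈ componentsOf N'ᶜ, IsBallPiece N' C')
    (hfr : ∀ C' ∈ componentsOf N'ᶜ, frontier C' ⊆ U' ∨ Disjoint (frontier C') U')
    {C : Set Z} (hC : C ∈ componentsOf Nᶜ) :
    ∃ C' ∈ componentsOf N'ᶜ, ∃ (U₁ : Set Z) (U₁' : Set M') (Φ₁ : Z → M') (Ψ₁ : M' → Z),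
      IsOpen U₁ ∧ N ∪ C ⊆ U₁ ∧ IsOpen U₁' ∧
      ContMDiffOn (𝓡 4) (𝓡 4) ∞ Φ₁ U₁ ∧ ContMDiffOn (𝓡 4) (𝓡 4) ∞ Ψ₁ U₁' ∧
      MapsTo Φ₁ U₁ U₁' ∧ MapsTo Ψ₁ U₁' U₁ ∧
      (∀ x ∈ U₁, Ψ₁ (Φ₁ x) = x) ∧ (∀ y ∈ U₁', Φ₁ (Ψ₁ y) = y) ∧
      Φ₁ '' (N ∪ C) = (N' ∪ C') ∩ U₁' ∧
      ∀ C'' ∈ componentsOf (N' ∪ C')ᶜ, frontier C'' ⊆ U₁' ∨ Disjoint (frontier C'') U₁' := by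
  classical
  haveI : LocallyConnectedSpace M' :=
    ChartedSpace.locallyConnectedSpace (EuclideanSpace ℝ (Fin 4)) M'
  -- the ball piece `C`, its partner `C'`, and the ball filling
  obtain ⟨ι, hι, hιo, hιC, hιN⟩ := hZ C hC
  obtain ⟨C', hC', ι', hι', hι'o, hι'C, hι'N, hSS', hS'U⟩ :=
    exists_ballPiece_frontier_image_eq hN' hU hNU hU' hΦc.continuousOn hΨc.continuousOn hΦ
      hleft hright hΦN hZ hM hfr hC hι hιC hιN
  obtain ⟨F, Finv, δ, hδ, hF, hFΦ, hF1, hFimg, hFo, hFinv, hFleft⟩ :=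
    exists_capFill hcerf hU hNU hU' hΦc hΨc hΦ hΨ hleft hright hΦN hC hι hιo hιC hιN hC' hι' hι'o
      hι'C hι'N hSS'
  have hιc : Continuous ι := hι.contMDiff.continuous
  have hιinj : Injective ι := hι.isEmbedding.injective
  have hιoe : Topology.IsOpenEmbedding ι := ⟨hι.isEmbedding, hιo⟩
  have hι'c : Continuous ι' := hι'.contMDiff.continuous
  have hι'inj : Injective ι' := hι'.isEmbedding.injective
  have hι'oe : Topology.IsOpenEmbedding ι' := ⟨hι'.isEmbedding, hι'o⟩
  have hCN := disjoint_of_mem_componentsOf_compl hC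
  have hC'N := disjoint_of_mem_componentsOf_compl hC'
  have hmem := IsBallPiece.mem_iff_of_witness hCN hιC hιN
  have hmem' := IsBallPiece.mem_iff_of_witness hC'N hι'C hι'N
  have hinΦ : ∀ z ∈ U, z ∈ N → Φ z ∈ N' := fun z _ hzN => by
    have : Φ z ∈ Φ '' N := mem_image_of_mem Φ hzN
    rw [hΦN] at this
    exact this.1
  have hinΨ : ∀ y ∈ U', y ∈ N' → Ψ y ∈ N := fun y hy hyN => by
    obtain ⟨z, hz, rfl⟩ := (hΦN.symm ▸ ⟨hyN, hy⟩ : y ∈ Φ '' N)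
    rw [hleft z (hNU hz)]
    exact hz
  set eι := hιoe.toOpenPartialHomeomorph ι with heι
  set eι' := hι'oe.toOpenPartialHomeomorph ι' with heι'
  have heιs : ∀ x, eι.symm (ι x) = x := fun x => hιoe.toOpenPartialHomeomorph_left_inv
  have heι's : ∀ y, eι'.symm (ι' y) = y := fun y => hι'oe.toOpenPartialHomeomorph_left_inv
  have heιc : ContMDiffOn (𝓡 4) 𝓘(ℝ, EuclideanSpace ℝ (Fin 4)) ∞ eι.symm (range ι) :=
    contMDiffOn_symm_of_isSmoothEmbedding hι hιoe
  have heι'c : ContMDiffOn (𝓡 4) 𝓘(ℝ, EuclideanSpace ℝ (Fin 4)) ∞ eι'.symm (range ι') :=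
    contMDiffOn_symm_of_isSmoothEmbedding hι' hι'oe
  -- the closed collar `K = ι'(𝔻⁴)` and the shrunk neighbourhood `U₀`
  set K : Set M' := ι' '' closedBall 0 1 with hKdef
  have hKc : IsClosed K := ((isCompact_closedBall _ _).image hι'c).isClosed
  set V : Set Z := ι '' ball 0 (1 + δ) with hVdef
  have hVo : IsOpen V := hιoe.isOpenMap _ isOpen_ball
  set U₀ : Set Z := (U ∩ Φ ⁻¹' Kᶜ) ∪ (U ∩ V) with hU₀def
  have hU₀o : IsOpen U₀ :=
    (hΦc.continuousOn.isOpen_inter_preimage hU hKc.isOpen_compl).union (hU.inter hVo)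
  have hU₀U : U₀ ⊆ U := union_subset inter_subset_left inter_subset_left
  -- points of `N` mapped into `K` lie on the sphere `ι S³`
  have hK_N : ∀ z ∈ U, z ∈ N → Φ z ∈ K → z ∈ ι '' sphere 0 1 := by
    intro z hzU hzN hzK
    obtain ⟨y, hy, hye⟩ := hzK
    have hy1 : ‖y‖ = 1 := by
      rcases (mem_closedBall_zero_iff.1 hy).lt_or_eq with h | h
      · exfalso
        have : ι' y ∈ C' := hι'C ▸ mem_image_of_mem ι' (mem_ball_zero_iff.2 h)
        exact hC'N.le_bot ⟨this, hye.symm ▸ hinΦ z hzU hzN⟩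
      · exact h
    have : Φ z ∈ Φ '' (ι '' sphere 0 1) := by
      rw [hSS', ← hye]
      exact mem_image_of_mem ι' (mem_sphere_zero_iff_norm.2 hy1)
    obtain ⟨w, hw, hwe⟩ := this
    obtain ⟨x, hx, rfl⟩ := hw
    have hxU : ι x ∈ U := hNU ((hmem x).2 (mem_sphere_zero_iff_norm.1 hx).ge)
    rw [← hleft z hzU, ← hwe, hleft _ hxU]
    exact mem_image_of_mem ι hx
  have hNU₀ : N ⊆ U₀ := by
    intro z hz
    by_cases hzK : Φ z ∈ K
    · obtain ⟨x, hx, rfl⟩ := hK_N z (hNU hz) hz hzK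
      refine Or.inr ⟨hNU hz, mem_image_of_mem ι ?_⟩
      rw [mem_ball_zero_iff, mem_sphere_zero_iff_norm.1 hx]; linarith
    · exact Or.inl ⟨hNU hz, hzK⟩
  -- the two open pieces `A`, `V` of the new neighbourhood and their images
  set A : Set Z := U₀ \ ι '' closedBall 0 1 with hAdef
  have hAo : IsOpen A := hU₀o.sdiff ((isCompact_closedBall _ _).image hιc).isClosed
  have hAU : A ⊆ U := fun z hz => hU₀U hz.1
  set A' : Set M' := Φ '' A with hA'def
  have hA'o : IsOpen A' := isOpen_image_of_inverse hU' hΨc.continuousOn hΦ hΨ hleft hright hAo hAU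
  have hA'U : A' ⊆ U' := by rintro _ ⟨z, hz, rfl⟩; exact hΦ (hAU hz)
  set V' : Set M' := ι' '' (F '' ball 0 (1 + δ)) with hV'def
  have hV'o : IsOpen V' := hι'oe.isOpenMap _ hFo
  set U₁ : Set Z := A ∪ V with hU₁def
  set U₁' : Set M' := A' ∪ V' with hU₁'def
  -- the glued maps
  set Φ₁ : Z → M' := fun z => if z ∈ V then ι' (F (eι.symm z)) else Φ z with hΦ₁def
  set Ψ₁ : M' → Z := fun y => if y ∈ V' then ι (Finv (eι'.symm y)) else Ψ y with hΨ₁def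
  -- basic formulas
  have hmemV : ∀ {x : EuclideanSpace ℝ (Fin 4)}, ι x ∈ V ↔ ‖x‖ < 1 + δ := fun {x} => by
    rw [hVdef, hιinj.mem_set_image, mem_ball_zero_iff]
  have hmemV' : ∀ {w : EuclideanSpace ℝ (Fin 4)}, ι' w ∈ V' ↔ w ∈ F '' ball 0 (1 + δ) :=
    fun {w} => by rw [hV'def, hι'inj.mem_set_image]
  have hΦ₁ι : ∀ x : EuclideanSpace ℝ (Fin 4), ‖x‖ < 1 + δ → Φ₁ (ι x) = ι' (F x) := fun x hx => by
    simp only [hΦ₁def, if_pos (hmemV.2 hx), heιs]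
  have hΦ₁Φ : ∀ z, z ∉ V → Φ₁ z = Φ z := fun z hz => by simp only [hΦ₁def, if_neg hz]
  have hΨ₁ι' : ∀ w ∈ F '' ball 0 (1 + δ), Ψ₁ (ι' w) = ι (Finv w) := fun w hw => by
    simp only [hΨ₁def, if_pos (hmemV'.2 hw), heι's]
  have hΨ₁Ψ : ∀ y, y ∉ V' → Ψ₁ y = Ψ y := fun y hy => by simp only [hΨ₁def, if_neg hy]
  -- on the overlap `A ∩ V` the two definitions agree
  have hA_norm : ∀ x : EuclideanSpace ℝ (Fin 4), ι x ∈ A → 1 < ‖x‖ := fun x hx => by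
    by_contra h
    exact hx.2 (mem_image_of_mem ι (mem_closedBall_zero_iff.2 (not_lt.1 h)))
  have hagree : ∀ z ∈ A, z ∈ V → Φ₁ z = Φ z := by
    rintro z hzA ⟨x, hx, rfl⟩
    rw [mem_ball_zero_iff] at hx
    rw [hΦ₁ι x hx]
    exact (hFΦ x (by linarith [hA_norm x hzA]) hx).2.2
  have hΦ₁A : ∀ z ∈ A, Φ₁ z = Φ z := fun z hz => by
    by_cases hzV : z ∈ V
    · exact hagree z hz hzV
    · exact hΦ₁Φ z hzV
  -- key separation property of `U₀`: outside the collar, `Φ` avoids `V'`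
  have hsep : ∀ z ∈ A, z ∉ V → Φ z ∉ V' := by
    intro z hzA hzV hzV'
    obtain ⟨w, hw, hwe⟩ := hzV'
    rcases hFimg w hw with hw1 | ⟨x, hx1, hx2, rfl⟩
    · -- `Φ z ∈ ι'(𝔹⁴) ⊆ K`, impossible for `z ∈ U₀ ∖ V`
      have hzK : Φ z ∈ K := ⟨w, mem_closedBall_zero_iff.2 hw1.le, hwe⟩
      rcases hzA.1 with ⟨-, h⟩ | ⟨-, h⟩
      · exact h hzK
      · exact hzV h
    · -- `Φ z = ι' (F x) = Φ (ι x)` with `ι x ∈ V`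
      have h := hFΦ x (by linarith) hx2
      rw [h.2.2] at hwe
      have : z = ι x := by rw [← hleft z (hAU hzA), ← hwe, hleft _ h.1]
      exact hzV (this ▸ hmemV.2 hx2)
  -- inverse identities
  have hleft₁ : ∀ z ∈ U₁, Ψ₁ (Φ₁ z) = z := by
    intro z hz
    by_cases hzV : z ∈ V
    · obtain ⟨x, hx, rfl⟩ := hzV
      rw [mem_ball_zero_iff] at hx
      rw [hΦ₁ι x hx, hΨ₁ι' (F x) (mem_image_of_mem F (mem_ball_zero_iff.2 hx)), hFleft x
        (mem_ball_zero_iff.2 hx)]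
    · have hzA : z ∈ A := hz.resolve_right hzV
      rw [hΦ₁Φ z hzV, hΨ₁Ψ _ (hsep z hzA hzV), hleft z (hAU hzA)]
  have hright₁ : ∀ y ∈ U₁', Φ₁ (Ψ₁ y) = y := by
    intro y hy
    by_cases hyV' : y ∈ V'
    · obtain ⟨w, hw, rfl⟩ := hyV'
      obtain ⟨x, hx, rfl⟩ := hw
      rw [hΨ₁ι' (F x) (mem_image_of_mem F hx), hFleft x hx, hΦ₁ι x (mem_ball_zero_iff.1 hx)]
    · obtain ⟨z, hzA, rfl⟩ := hy.resolve_right hyV'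
      rw [hΨ₁Ψ _ hyV', hleft z (hAU hzA), hΦ₁A z hzA]
  have hmaps₁ : MapsTo Φ₁ U₁ U₁' := by
    intro z hz
    by_cases hzV : z ∈ V
    · obtain ⟨x, hx, rfl⟩ := hzV
      rw [hΦ₁ι x (mem_ball_zero_iff.1 hx)]
      exact Or.inr (mem_image_of_mem ι' (mem_image_of_mem F hx))
    · have hzA : z ∈ A := hz.resolve_right hzV
      rw [hΦ₁Φ z hzV]
      exact Or.inl (mem_image_of_mem Φ hzA)
  have hmaps₁' : MapsTo Ψ₁ U₁' U₁ := by
    intro y hy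
    by_cases hyV' : y ∈ V'
    · obtain ⟨w, hw, rfl⟩ := hyV'
      obtain ⟨x, hx, rfl⟩ := hw
      rw [hΨ₁ι' (F x) (mem_image_of_mem F hx), hFleft x hx]
      exact Or.inr (mem_image_of_mem ι hx)
    · obtain ⟨z, hzA, rfl⟩ := hy.resolve_right hyV'
      rw [hΨ₁Ψ _ hyV', hleft z (hAU hzA)]
      exact Or.inl hzA
  -- smoothness of `Φ₁`
  have hFm : ContMDiffOn 𝓘(ℝ, EuclideanSpace ℝ (Fin 4)) 𝓘(ℝ, EuclideanSpace ℝ (Fin 4)) ∞ F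
      (ball 0 (1 + δ)) := contMDiffOn_iff_contDiffOn.2 hF
  have hFinvm : ContMDiffOn 𝓘(ℝ, EuclideanSpace ℝ (Fin 4)) 𝓘(ℝ, EuclideanSpace ℝ (Fin 4)) ∞ Finv
      (F '' ball 0 (1 + δ)) := contMDiffOn_iff_contDiffOn.2 hFinv
  have hΦ₁V : ContMDiffOn (𝓡 4) (𝓡 4) ∞ Φ₁ V := by
    have h1 : ContMDiffOn (𝓡 4) 𝓘(ℝ, EuclideanSpace ℝ (Fin 4)) ∞ eι.symm V :=
      heιc.mono (image_subset_range _ _)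
    have h2 : ContMDiffOn (𝓡 4) 𝓘(ℝ, EuclideanSpace ℝ (Fin 4)) ∞ (fun z => F (eι.symm z)) V := by
      refine hFm.comp h1 ?_
      rintro _ ⟨x, hx, rfl⟩
      show eι.symm (ι x) ∈ ball 0 (1 + δ)
      rwa [heιs]
    have h3 : ContMDiffOn (𝓡 4) (𝓡 4) ∞ (fun z => ι' (F (eι.symm z))) V :=
      hι'.contMDiff.comp_contMDiffOn h2
    refine h3.congr fun z hz => ?_
    simp only [hΦ₁def, if_pos hz]
  have hΦ₁As : ContMDiffOn (𝓡 4) (𝓡 4) ∞ Φ₁ A := (hΦc.mono hAU).congr hΦ₁A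
  have hΦ₁c : ContMDiffOn (𝓡 4) (𝓡 4) ∞ Φ₁ U₁ := by
    intro z hz
    rcases hz with hz | hz
    · exact (hΦ₁As.contMDiffAt (hAo.mem_nhds hz)).contMDiffWithinAt
    · exact (hΦ₁V.contMDiffAt (hVo.mem_nhds hz)).contMDiffWithinAt
  -- smoothness of `Ψ₁`
  have hΨ₁V : ContMDiffOn (𝓡 4) (𝓡 4) ∞ Ψ₁ V' := by
    have h1 : ContMDiffOn (𝓡 4) 𝓘(ℝ, EuclideanSpace ℝ (Fin 4)) ∞ eι'.symm V' :=
      heι'c.mono (image_subset_range _ _)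
    have h2 : ContMDiffOn (𝓡 4) 𝓘(ℝ, EuclideanSpace ℝ (Fin 4)) ∞ (fun y => Finv (eι'.symm y)) V' := by
      refine hFinvm.comp h1 ?_
      rintro _ ⟨w, hw, rfl⟩
      show eι'.symm (ι' w) ∈ F '' ball 0 (1 + δ)
      rwa [heι's]
    have h3 : ContMDiffOn (𝓡 4) (𝓡 4) ∞ (fun y => ι (Finv (eι'.symm y))) V' :=
      hι.contMDiff.comp_contMDiffOn h2
    refine h3.congr fun y hy => ?_
    simp only [hΨ₁def, if_pos hy]
  have hΨ₁A' : ∀ y ∈ A', Ψ₁ y = Ψ y := by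
    rintro _ ⟨z, hzA, rfl⟩
    by_cases hzV : z ∈ V
    · -- then `Φ z = Φ₁ z ∈ V'` and both formulas give `z`
      have h1 : Ψ₁ (Φ₁ z) = z := hleft₁ z (Or.inl hzA)
      rw [hagree z hzA hzV] at h1
      rw [h1, hleft z (hAU hzA)]
    · exact hΨ₁Ψ _ (hsep z hzA hzV)
  have hΨ₁As : ContMDiffOn (𝓡 4) (𝓡 4) ∞ Ψ₁ A' := (hΨc.mono hA'U).congr hΨ₁A'
  have hΨ₁c : ContMDiffOn (𝓡 4) (𝓡 4) ∞ Ψ₁ U₁' := by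
    intro y hy
    rcases hy with hy | hy
    · exact (hΨ₁As.contMDiffAt (hA'o.mem_nhds hy)).contMDiffWithinAt
    · exact (hΨ₁V.contMDiffAt (hV'o.mem_nhds hy)).contMDiffWithinAt
  -- the new closed sets
  have hNCU₁ : N ∪ C ⊆ U₁ := by
    rintro z (hz | hz)
    · by_cases h : z ∈ ι '' closedBall 0 1
      · obtain ⟨x, hx, rfl⟩ := h
        refine Or.inr (mem_image_of_mem ι ?_)
        rw [mem_ball_zero_iff]
        linarith [mem_closedBall_zero_iff.1 hx]
      · exact Or.inl ⟨hNU₀ hz, h⟩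
    · rw [← hιC] at hz
      obtain ⟨x, hx, rfl⟩ := hz
      refine Or.inr (mem_image_of_mem ι ?_)
      rw [mem_ball_zero_iff] at hx ⊢
      linarith
  have hVNC : V ⊆ N ∪ C := by
    rintro _ ⟨x, hx, rfl⟩
    by_cases h1 : ‖x‖ < 1
    · exact Or.inr (hιC ▸ mem_image_of_mem ι (mem_ball_zero_iff.2 h1))
    · exact Or.inl ((hmem x).2 (not_lt.1 h1))
  have himage : Φ₁ '' (N ∪ C) = (N' ∪ C') ∩ U₁' := by
    apply Subset.antisymm
    · rintro _ ⟨z, hz, rfl⟩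
      refine ⟨?_, hmaps₁ (hNCU₁ hz)⟩
      by_cases hzV : z ∈ V
      · obtain ⟨x, hx, rfl⟩ := hzV
        rw [mem_ball_zero_iff] at hx
        rw [hΦ₁ι x hx]
        by_cases hx1 : ‖x‖ < 1
        · have : F x ∈ ball 0 1 := hF1 ▸ mem_image_of_mem F (mem_ball_zero_iff.2 hx1)
          exact Or.inr (hι'C ▸ mem_image_of_mem ι' this)
        · have h := hFΦ x (by linarith) hx
          rw [h.2.2]
          exact Or.inl (hinΦ _ h.1 ((hmem x).2 (not_lt.1 hx1)))
      · have hzA : z ∈ A := (hNCU₁ hz).resolve_right hzV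
        have hzN : z ∈ N := hz.resolve_right fun hzC => hzV ?_
        · rw [hΦ₁Φ z hzV]
          exact Or.inl (hinΦ z (hAU hzA) hzN)
        · rw [← hιC] at hzC
          obtain ⟨x, hx, rfl⟩ := hzC
          refine mem_image_of_mem ι ?_
          rw [mem_ball_zero_iff] at hx ⊢
          linarith
    · rintro y ⟨hyN, hyU⟩
      by_cases hyV' : y ∈ V'
      · obtain ⟨w, ⟨x, hx, rfl⟩, rfl⟩ := hyV'
        refine ⟨ι x, hVNC (mem_image_of_mem ι hx), hΦ₁ι x (mem_ball_zero_iff.1 hx)⟩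
      · obtain ⟨z, hzA, rfl⟩ := hyU.resolve_right hyV'
        have hzV : z ∉ V := by
          intro hzV
          apply hyV'
          rw [← hagree z hzA hzV]
          obtain ⟨x, hx, rfl⟩ := hzV
          rw [hΦ₁ι x (mem_ball_zero_iff.1 hx)]
          exact mem_image_of_mem ι' (mem_image_of_mem F hx)
        refine ⟨z, ?_, hΦ₁Φ z hzV⟩
        rcases hyN with hyN | hyC'
        · have := hinΨ (Φ z) (hΦ (hAU hzA)) hyN
          rw [hleft z (hAU hzA)] at this
          exact Or.inl this
        · exfalso
          have hzK : Φ z ∈ K := by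
            rw [← hι'C] at hyC'
            obtain ⟨w, hw, hwe⟩ := hyC'
            exact ⟨w, ball_subset_closedBall hw, hwe⟩
          rcases hzA.1 with ⟨-, h⟩ | ⟨-, h⟩
          · exact h hzK
          · exact hzV h
  -- the boundary spheres of the remaining `M'`-pieces
  have hfr₁ : ∀ C'' ∈ componentsOf (N' ∪ C')ᶜ,
      frontier C'' ⊆ U₁' ∨ Disjoint (frontier C'') U₁' := by
    intro C'' hC''
    rw [componentsOf_compl_union_eq hC'] at hC''
    obtain ⟨hC''m, hne⟩ := hC''
    rw [mem_singleton_iff] at hne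
    have hC''o : IsOpen C'' := isOpen_of_mem_componentsOf hN'.isOpen_compl hC''m
    have hC''N := disjoint_of_mem_componentsOf_compl hC''m
    have hfrC'' : frontier C'' = closure C'' \ C'' := hC''o.frontier_eq
    have hfrN' : frontier C'' ⊆ N' :=
      hfrC'' ▸ IsBallPiece.closure_diff_subset (hM C'' hC''m) hC''N
    rcases hfr C'' hC''m with h | h
    · left
      intro y hy
      have hyN' := hfrN' hy
      obtain ⟨z, hz, rfl⟩ := (hΦN.symm ▸ ⟨hyN', h hy⟩ : y ∈ Φ '' N)
      refine Or.inl ⟨z, ⟨hNU₀ hz, fun hzι => ?_⟩, rfl⟩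
      obtain ⟨x, hx, rfl⟩ := hzι
      have hx1 : ‖x‖ = 1 := le_antisymm (mem_closedBall_zero_iff.1 hx) ((hmem x).1 hz)
      have h1 : Φ (ι x) ∈ closure C' \ C' := by
        rw [IsBallPiece.closure_diff_eq_of_witness hι'c hι'inj hι'C, ← hSS']
        exact mem_image_of_mem Φ (mem_image_of_mem ι (mem_sphere_zero_iff_norm.2 hx1))
      have h2 : Φ (ι x) ∈ closure C'' \ C'' := hfrC'' ▸ hy
      exact hne (IsBallPiece.eq_of_mem_closure hC''m hC' (hM C'' hC''m) h2 h1.1)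
    · right
      rw [Set.disjoint_left]
      rintro y hy (hyA' | hyV')
      · exact h.le_bot ⟨hy, hA'U hyA'⟩
      · obtain ⟨w, hw, rfl⟩ := hyV'
        rcases hFimg w hw with hw1 | ⟨x, hx1, hx2, rfl⟩
        · exact hC'N.le_bot ⟨hι'C ▸ mem_image_of_mem ι' (mem_ball_zero_iff.2 hw1), hfrN' hy⟩
        · have hh := hFΦ x (by linarith) hx2
          rw [hh.2.2] at hy
          exact h.le_bot ⟨hy, hh.2.1⟩
  exact ⟨C', hC', U₁, U₁', Φ₁, Ψ₁, hAo.union hVo, hNCU₁, hA'o.union hV'o, hΦ₁c, hΨ₁c, hmaps₁,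
    hmaps₁', hleft₁, hright₁, himage, hfr₁⟩


/-! ### All ball pieces absorbed: `Φ` extends over `Z` -/

/-- **Absorbing all ball pieces** (induction on their number). In the setting of the module
docstring — closed `N ⊆ Z`, `N' ⊆ M'`, a diffeomorphism `Φ : U → U'` of open neighbourhoods with
`Φ '' N = N' ∩ U'`, finitely many pieces on both sides, all collared balls, boundary spheres of
the `M'`-pieces inside `U'` or disjoint from it — and given Cerf's theorem, `Φ` can be replaced
by a diffeomorphism **of all of `Z`** onto an open subset of `M'` (`exists_absorb_ballPiece`,
`k` times). [cite: CerfDiffeoSphere1968, Ch. I §1, Théorème 1 and Corollaire 1] -/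
theorem exists_diffeoOn_univ_of_ballPieces (hcerf : cerf_pi0Diff_sphere_three) (k : ℕ) :
    ∀ {N : Set Z} {N' : Set M'} {U : Set Z} {U' : Set M'} {Φ : Z → M'} {Ψ : M' → Z},
      IsClosed N → IsClosed N' → IsOpen U → N ⊆ U → IsOpen U' →
      ContMDiffOn (𝓡 4) (𝓡 4) ∞ Φ U → ContMDiffOn (𝓡 4) (𝓡 4) ∞ Ψ U' →
      MapsTo Φ U U' → MapsTo Ψ U' U →
      (∀ x ∈ U, Ψ (Φ x) = x) → (∀ y ∈ U', Φ (Ψ y) = y) → Φ '' N = N' ∩ U' →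
      (componentsOf Nᶜ).Finite → (componentsOf Nᶜ).ncard = k →
      (∀ C ∈ componentsOf Nᶜ, IsBallPiece N C) →
      (componentsOf N'ᶜ).Finite → (∀ C' ∈ componentsOf N'ᶜ, IsBallPiece N' C') →
      (∀ C' ∈ componentsOf N'ᶜ, frontier C' ⊆ U' ∨ Disjoint (frontier C') U') →
      ∃ (U₁' : Set M') (Φ₁ : Z → M') (Ψ₁ : M' → Z), IsOpen U₁' ∧
        ContMDiff (𝓡 4) (𝓡 4) ∞ Φ₁ ∧ ContMDiffOn (𝓡 4) (𝓡 4) ∞ Ψ₁ U₁' ∧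
        MapsTo Φ₁ univ U₁' ∧ MapsTo Ψ₁ U₁' univ ∧
        (∀ x, Ψ₁ (Φ₁ x) = x) ∧ ∀ y ∈ U₁', Φ₁ (Ψ₁ y) = y := by
  haveI : LocallyConnectedSpace M' :=
    ChartedSpace.locallyConnectedSpace (EuclideanSpace ℝ (Fin 4)) M'
  haveI : LocallyConnectedSpace Z :=
    ChartedSpace.locallyConnectedSpace (EuclideanSpace ℝ (Fin 4)) Z
  induction k with
  | zero =>
    intro N N' U U' Φ Ψ hN hN' hU hNU hU' hΦc hΨc hΦ hΨ hleft hright hΦN hfin hcard hZ hfin' hM hfr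
    have hempty : componentsOf Nᶜ = ∅ := (ncard_eq_zero hfin).1 hcard
    have hNuniv : N = univ := by
      have h := sUnion_componentsOf Nᶜ
      rw [hempty, sUnion_empty] at h
      exact compl_empty_iff.1 h.symm
    have hUuniv : U = univ := univ_subset_iff.1 (hNuniv ▸ hNU)
    subst hUuniv
    exact ⟨U', Φ, Ψ, hU', contMDiffOn_univ.1 hΦc, hΨc, hΦ, hΨ, fun x => hleft x (mem_univ x), hright⟩
  | succ k ih =>
    intro N N' U U' Φ Ψ hN hN' hU hNU hU' hΦc hΨc hΦ hΨ hleft hright hΦN hfin hcard hZ hfin' hM hfr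
    obtain ⟨C, hC⟩ := nonempty_of_ncard_ne_zero (s := componentsOf Nᶜ) (by omega)
    obtain ⟨C', hC', U₁, U₁', Φ₁, Ψ₁, hU₁, hNCU₁, hU₁', hΦ₁c, hΨ₁c, hmaps, hmaps', hleft₁, hright₁,
      himage, hfr₁⟩ :=
      exists_absorb_ballPiece hcerf hN' hU hNU hU' hΦc hΨc hΦ hΨ hleft hright hΦN hZ hM hfr hC
    refine ih (isClosed_union_of_mem_componentsOf hN hC) (isClosed_union_of_mem_componentsOf hN' hC')
      hU₁ hNCU₁ hU₁' hΦ₁c hΨ₁c hmaps hmaps' hleft₁ hright₁ himage ?_ ?_ ?_ ?_ ?_ hfr₁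
    · rw [componentsOf_compl_union_eq hC]
      exact hfin.sdiff
    · rw [componentsOf_compl_union_eq hC, ncard_sdiff_singleton_of_mem hC, hcard]
      rfl
    · intro D hD
      rw [componentsOf_compl_union_eq hC] at hD
      exact (hZ D hD.1).mono subset_union_left
    · rw [componentsOf_compl_union_eq hC']
      exact hfin'.sdiff
    · intro D hD
      rw [componentsOf_compl_union_eq hC'] at hD
      exact (hM D hD.1).mono subset_union_left

/-- **A compact connected `Z` all of whose pieces are balls is diffeomorphic to a component of
`M'`** (setting of the module docstring; Cerf). By `exists_diffeoOn_univ_of_ballPieces`, `Φ`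
extends to a diffeomorphism of `Z` onto an open subset `Y ⊆ M'`; `Y` is compact, hence closed,
and connected, so it is a connected component of `M'`, and `Z ≅ Y` as manifolds (`Y` with
Mathlib's open-submanifold structure). This is the form in which the comparison of the two
cappings enters the deduction of Hamilton's Cor. 1.2(a) from Chen–Zhu's Thm. 1.1: a capped-off
piece of `M_k` is one of the components of `M_{k+1}`.
[cite: ChenZhu2006, Thm. 1.1 (ii)–(iii) (p. 3) and §5, p. 25] -/
theorem exists_diffeomorph_component_of_ballPieces [CompactSpace Z] [ConnectedSpace Z]
    (hcerf : cerf_pi0Diff_sphere_three)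
    {N : Set Z} {N' : Set M'} {U : Set Z} {U' : Set M'} {Φ : Z → M'} {Ψ : M' → Z}
    (hN : IsClosed N) (hN' : IsClosed N') (hU : IsOpen U) (hNU : N ⊆ U) (hU' : IsOpen U')
    (hΦc : ContMDiffOn (𝓡 4) (𝓡 4) ∞ Φ U) (hΨc : ContMDiffOn (𝓡 4) (𝓡 4) ∞ Ψ U')
    (hΦ : MapsTo Φ U U') (hΨ : MapsTo Ψ U' U)
    (hleft : ∀ x ∈ U, Ψ (Φ x) = x) (hright : ∀ y ∈ U', Φ (Ψ y) = y) (hΦN : Φ '' N = N' ∩ U')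
    (hfin : (componentsOf Nᶜ).Finite) (hZ : ∀ C ∈ componentsOf Nᶜ, IsBallPiece N C)
    (hfin' : (componentsOf N'ᶜ).Finite) (hM : ∀ C' ∈ componentsOf N'ᶜ, IsBallPiece N' C')
    (hfr : ∀ C' ∈ componentsOf N'ᶜ, frontier C' ⊆ U' ∨ Disjoint (frontier C') U') :
    ∃ (Y : Opens M') (y : M'), (Y : Set M') = connectedComponent y ∧
      Nonempty (Z ≃ₘ⟮𝓡 4, 𝓡 4⟯ Y) := by
  obtain ⟨U₁', Φ₁, Ψ₁, hU₁', hΦ₁, hΨ₁, hmaps, hmaps', hleft₁, hright₁⟩ :=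
    exists_diffeoOn_univ_of_ballPieces hcerf _ hN hN' hU hNU hU' hΦc hΨc hΦ hΨ hleft hright hΦN
      hfin rfl hZ hfin' hM hfr
  have hrange : range Φ₁ = U₁' := by
    rw [← image_univ]
    exact image_eq_of_inverse hmaps hmaps' hright₁
  obtain ⟨z₀⟩ := (inferInstance : Nonempty Z)
  have hclopen : IsClopen U₁' :=
    ⟨by rw [← hrange]; exact (isCompact_range hΦ₁.continuous).isClosed, hU₁'⟩
  have hconn : IsPreconnected U₁' := by
    rw [← hrange]
    exact (isPreconnected_range hΦ₁.continuous)
  refine ⟨⟨U₁', hU₁'⟩, Φ₁ z₀, ?_, ⟨?_⟩⟩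
  · exact Subset.antisymm (hconn.subset_connectedComponent (hmaps (mem_univ z₀)))
      (hclopen.connectedComponent_subset (hmaps (mem_univ z₀)))
  · exact
      { toFun := fun z => ⟨Φ₁ z, hmaps (mem_univ z)⟩
        invFun := fun y => Ψ₁ y
        left_inv := fun z => hleft₁ z
        right_inv := fun y => Subtype.ext (hright₁ y y.2)
        contMDiff_toFun := (ContMDiff.subtypeVal_comp_iff ⟨U₁', hU₁'⟩ _).1 hΦ₁
        contMDiff_invFun := hΨ₁.comp_contMDiff contMDiff_subtype_val fun y => y.2 }

end Absorb

end Literature.Geometry.Riemannian
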